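import Summits.RiemannHypothesis.RiemannHypothesis.Theorems.GroundBartaEvenWinsBeyondArchCosinePolyBound
import Literature.NumberTheory.LFunctions.WeilTwoPrimeMinorant
import HarnessLib

/-!
# RiemannHypothesis / GroundBarta machinery — PHANTOM LEVEL CERTIFICATES (2/2): the tail level of a phantom-rippled two-prime
weight from two cosine-polynomial checks

Helper file (`--supports stmt-RiemannHypothesis-18085`; seat rh-explicit-weil-6, memo `run/shared/lean/pub/rh-explicit/WEIL6-APRIME.md`).
Format A′ of the Weil-positivity ladder replaces the frequency weight `w₂₃` of the two-prime analytic form by `w₂₃ + P` with a SEPARABLE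
phantom `P(t) = Σ_{j ≥ 2} (z_j/K) cos(j t log 2) + Σ_{k ≥ 2} (y_k/K) cos(k t log 3)` (integer coefficients `z_j`, `y_k` at scale `K`; the
entries with `j log 2 < 2c` resp. `k log 3 < 2c` are `0` in the applications, where the phantom identity of `…PhantomRipples.lean` makes `P`
invisible to the functional).  The certificates (`WeilCert23X`, seat weil-1) take as a HYPOTHESIS the tail level
`∀ |t| ≥ T, wL ≤ w₂₃(t) + P(t)`.  This file discharges that hypothesis from three kernel checks:
* `CosPoly.check S d (c₂ :: (−A₂) :: zs)` and `CosPoly.check S d (c₃ :: (−B₃) :: ys)` (file 1/2: the two cosine polynomials in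
  `θ₂ = t log 2`, `θ₃ = t log 3` are `> 0` on the circle), where `A₂`, `B₃` are integers within `1` of `K·√2 log 2`, `K·2 log 3/√3`
  (checked against the engine enclosures `cZeroFI`, `cThreeFI`), so that `−a cos θ₂ + Σ (z_j/K) cos(jθ₂) ≥ −(c₂+1)/K` etc.;
* the level inequality `K·wL + (c₂ + 1) + (c₃ + 1) ≤ K · wLoZ(T)` against the engine's certified lower bound `wLoZ ≤ Re ψ(¼ + iT/2)`
  (`WeilSeriesZ.lean`), combined with the monotonicity of `Re ψ(¼ + it/2)` in `|t|` (`reDigammaQuarter_mono`).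
Main theorem **`SepLevelCP.level_of_check`**.  Everything is proved; no named facts.
-/

set_option linter.dupNamespace false

noncomputable section

open scoped Real BigOperators

namespace Summit.RiemannHypothesis.RiemannHypothesis.Theorems.EvenWinsBeyondArch

open Literature.NumberTheory.LFunctions
open Literature.Analysis.ValidatedNumerics Literature.Analysis.ValidatedNumerics.Numerics
open Literature.Analysis.SpecialFunctions

/-! ## Separable phantoms with integer coefficients at scale `K` -/

/-- `Σ_{i<|zs|} (zs[i]/K) cos((i+2)θ)`: harmonics from `2` on, integer coefficients at scale `K`. [folklore] -/
def harmSum (K : ℕ) (zs : List ℤ) (θ : ℝ) : ℝ :=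
  ∑ i ∈ Finset.range zs.length, ((zs.getD i 0 : ℤ) : ℝ) / K * Real.cos ((i + 2 : ℕ) * θ)

/-- The separable phantom `P(t) = harmSum K zs (t log 2) + harmSum K ys (t log 3)`. [folklore] -/
def sepPhantomZ (K : ℕ) (zs ys : List ℤ) (t : ℝ) : ℝ :=
  harmSum K zs (t * Real.log 2) + harmSum K ys (t * Real.log 3)

/-- `harmSum` is even in `θ`'s sign through `t`: `harmSum K zs (|t| L) = harmSum K zs (t L)`. [folklore] -/
theorem harmSum_abs_mul (K : ℕ) (zs : List ℤ) (t L : ℝ) : harmSum K zs (|t| * L) = harmSum K zs (t * L) := by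
  unfold harmSum
  refine Finset.sum_congr rfl fun i _ ↦ ?_
  rw [show ((i + 2 : ℕ) : ℝ) * (|t| * L) = |t| * (((i + 2 : ℕ) : ℝ) * L) by ring, cos_abs_mul,
    show t * (((i + 2 : ℕ) : ℝ) * L) = ((i + 2 : ℕ) : ℝ) * (t * L) by ring]

/-! ## The certificate -/

/-- A separable phantom LEVEL certificate: scale `K`, integer approximations `A₂ ≈ K√2 log 2`, `B₃ ≈ K·2log 3/√3`, constants `c₂, c₃`,
harmonic coefficients `zs` (for `cos(jθ₂)`, `j ≥ 2`) and `ys` (for `cos(kθ₃)`, `k ≥ 2`), checker parameters `S, d` (file 1/2) and the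
engine parameters `p, j, M` of `wLoZ`. [folklore] -/
structure SepLevelCP where
  /-- coefficient scale -/
  K : ℕ
  /-- integer within `1` of `K · √2 log 2` -/
  A2 : ℤ
  /-- integer within `1` of `K · 2 log 3 / √3` -/
  B3 : ℤ
  /-- constant of the `θ₂` polynomial (`K m₂ − 1`) -/
  c2 : ℤ
  /-- constant of the `θ₃` polynomial (`K m₃ − 1`) -/
  c3 : ℤ
  /-- coefficients of `cos(jθ₂)`, `j = 2, 3, …` -/
  zs : List ℤ
  /-- coefficients of `cos(kθ₃)`, `k = 2, 3, …` -/
  ys : List ℤ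
  /-- interval scale of `CosPoly.check` -/
  S : ℕ
  /-- bisection depth of `CosPoly.check` -/
  d : ℕ
  /-- engine precision of `wLoZ` -/
  p : ℕ
  /-- dyadic exponent of `T` in `wLoZ` -/
  j : ℕ
  /-- series length of `wLoZ` -/
  M : ℕ

namespace SepLevelCP

variable (s : SepLevelCP)

/-- The `θ₂` cosine polynomial `c₂ − A₂ cos θ + Σ zs[i] cos((i+2)θ)`. [folklore] -/
def cs2 : List ℤ := s.c2 :: (-s.A2) :: s.zs

/-- The `θ₃` cosine polynomial. [folklore] -/
def cs3 : List ℤ := s.c3 :: (-s.B3) :: s.ys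

/-- The phantom of the certificate. [folklore] -/
def phantom (t : ℝ) : ℝ := sepPhantomZ s.K s.zs s.ys t

/-- **The checker** at level `wL` and cut-off `T`: `K > 0`, `j ≥ 1`, `T` dyadic, the two amplitude brackets
`K·c₀⁺ ≤ A₂ + 1 ∧ A₂ − 1 ≤ K·c₀⁻` (and for `B₃`), the two cosine-polynomial checks, and `K wL + (c₂+1) + (c₃+1) ≤ K wLoZ(T)`. [folklore] -/
def check (wL T : ℚ) : Bool :=
  decide (0 < s.K) && decide (1 ≤ s.j) && decide (T * 2 ^ s.j = ((dyNum T s.j : ℕ) : ℚ)) &&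
    decide ((s.K : ℚ) * cZeroFI.hiQ ≤ (s.A2 : ℚ) + 1) && decide ((s.A2 : ℚ) - 1 ≤ (s.K : ℚ) * cZeroFI.loQ) &&
    decide ((s.K : ℚ) * cThreeFI.hiQ ≤ (s.B3 : ℚ) + 1) && decide ((s.B3 : ℚ) - 1 ≤ (s.K : ℚ) * cThreeFI.loQ) &&
    CosPoly.check s.S s.d s.cs2 && CosPoly.check s.S s.d s.cs3 &&
    decide ((s.K : ℚ) * wL + (s.c2 + 1) + (s.c3 + 1) ≤ (s.K : ℚ) * wLoZ s.p (dyNum T s.j) s.j s.M)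

variable {s}

/-- The cosine sum of `c :: a :: zs` splits as `c + a cos θ + K · harmSum K zs θ`. [folklore] -/
theorem cosSumFrom_cons_cons (K : ℕ) (hK : 0 < K) (c a : ℤ) (zs : List ℤ) (θ : ℝ) :
    CosPoly.cosSumFrom (c :: a :: zs) 0 θ = (c : ℝ) + (a : ℝ) * Real.cos θ + (K : ℝ) * harmSum K zs θ := by
  have hK' : (K : ℝ) ≠ 0 := by exact_mod_cast hK.ne'
  have e1 : CosPoly.cosSumFrom (c :: a :: zs) 0 θ =
      (c : ℝ) * Real.cos ((0 : ℕ) * θ) + ((a : ℝ) * Real.cos ((0 + 1 : ℕ) * θ) + CosPoly.cosSumFrom zs (0 + 1 + 1) θ) := by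
    simp only [CosPoly.cosSumFrom]
  rw [e1, CosPoly.cosSumFrom_eq_sum, harmSum, Finset.mul_sum]
  have e2 : ∀ i ∈ Finset.range zs.length,
      ((zs.getD i 0 : ℤ) : ℝ) * Real.cos (((0 + 1 + 1 + i : ℕ) : ℝ) * θ) =
        (K : ℝ) * (((zs.getD i 0 : ℤ) : ℝ) / K * Real.cos (((i + 2 : ℕ) : ℝ) * θ)) := by
    intro i _
    rw [show (0 + 1 + 1 + i : ℕ) = i + 2 by omega]
    field_simp
  rw [Finset.sum_congr rfl e2]
  simp only [Nat.cast_zero, zero_mul, Real.cos_zero, mul_one, zero_add, Nat.cast_one, one_mul]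
  ring

/-- One prime: if `c :: (−A) :: zs` passes `CosPoly.check` and `|K a − A| ≤ 1`, then `−a cos θ + harmSum K zs θ ≥ −(c+1)/K`. [folklore] -/
theorem ripple_lower {K S d : ℕ} (hK : 0 < K) {A c : ℤ} {zs : List ℤ} {a : ℝ}
    (hchk : CosPoly.check S d (c :: (-A) :: zs) = true) (hhi : (K : ℝ) * a ≤ (A : ℝ) + 1) (hlo : (A : ℝ) - 1 ≤ (K : ℝ) * a)
    (θ : ℝ) : -(((c : ℝ) + 1) / K) ≤ -a * Real.cos θ + harmSum K zs θ := by
  have hpos := CosPoly.cosSumFrom_pos_of_check hchk θ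
  rw [cosSumFrom_cons_cons K hK] at hpos
  have hKr : (0 : ℝ) < K := by exact_mod_cast hK
  have hc1 : Real.cos θ ≤ 1 := Real.cos_le_one θ
  have hc2 : -1 ≤ Real.cos θ := Real.neg_one_le_cos θ
  -- |(A − K a) cos θ| ≤ 1
  have hd : ((A : ℝ) - K * a) * Real.cos θ ≤ 1 := by
    rcases le_or_gt 0 (Real.cos θ) with h | h
    · nlinarith
    · nlinarith
  rw [neg_le, neg_add, neg_mul, neg_neg, ← sub_eq_add_neg, le_div_iff₀ hKr]
  push_cast at hpos
  nlinarith

/-- **Soundness of the separable phantom level certificate.** If `s.check wL T = true` then for every `|t| ≥ T`: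
`wL ≤ w₂₃(t) + P(t)` with `P = s.phantom`. [folklore] -/
theorem level_of_check {wL T : ℚ} (h : s.check wL T = true) {t : ℝ} (ht : (T : ℝ) ≤ |t|) :
    (wL : ℝ) ≤ weilTwoPrimeWeight t + s.phantom t := by
  unfold check at h
  simp only [Bool.and_eq_true, decide_eq_true_eq] at h
  obtain ⟨⟨⟨⟨⟨⟨⟨⟨⟨hK, hj⟩, hT⟩, hA1⟩, hA2⟩, hB1⟩, hB2⟩, hc2⟩, hc3⟩, hlev⟩ := h
  have hKr : (0 : ℝ) < s.K := by exact_mod_cast hK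
  -- amplitude brackets from the engine enclosures
  have ha_hi : (s.K : ℝ) * (Real.sqrt 2 * Real.log 2) ≤ (s.A2 : ℝ) + 1 := by
    have := FI.le_hiQ mem_cZeroFI
    have h' : ((s.K : ℚ) : ℝ) * (cZeroFI.hiQ : ℝ) ≤ (s.A2 : ℝ) + 1 := by exact_mod_cast hA1
    push_cast at h'
    nlinarith
  have ha_lo : (s.A2 : ℝ) - 1 ≤ (s.K : ℝ) * (Real.sqrt 2 * Real.log 2) := by
    have := FI.loQ_le mem_cZeroFI
    have h' : (s.A2 : ℝ) - 1 ≤ ((s.K : ℚ) : ℝ) * (cZeroFI.loQ : ℝ) := by exact_mod_cast hA2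
    push_cast at h'
    nlinarith
  have hb_hi : (s.K : ℝ) * (2 * Real.log 3 / Real.sqrt 3) ≤ (s.B3 : ℝ) + 1 := by
    have := FI.le_hiQ mem_cThreeFI
    have h' : ((s.K : ℚ) : ℝ) * (cThreeFI.hiQ : ℝ) ≤ (s.B3 : ℝ) + 1 := by exact_mod_cast hB1
    push_cast at h'
    nlinarith
  have hb_lo : (s.B3 : ℝ) - 1 ≤ (s.K : ℝ) * (2 * Real.log 3 / Real.sqrt 3) := by
    have := FI.loQ_le mem_cThreeFI
    have h' : (s.B3 : ℝ) - 1 ≤ ((s.K : ℚ) : ℝ) * (cThreeFI.loQ : ℝ) := by exact_mod_cast hB2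
    push_cast at h'
    nlinarith
  -- the two ripple bounds at θ₂ = |t| log 2, θ₃ = |t| log 3
  have h2 := ripple_lower hK hc2 ha_hi ha_lo (|t| * Real.log 2)
  have h3 := ripple_lower hK hc3 hb_hi hb_lo (|t| * Real.log 3)
  -- the digamma part: wLoZ ≤ Re ψ(T) ≤ Re ψ(|t|)
  have hTe : ((dyNum T s.j : ℕ) : ℝ) / 2 ^ s.j = (T : ℝ) := by
    have : (T : ℝ) * 2 ^ s.j = ((dyNum T s.j : ℕ) : ℝ) := by exact_mod_cast hT
    rw [← this, mul_div_assoc, div_self (by positivity), mul_one]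
  have hw := wLoZ_le s.p (dyNum T s.j) hj s.M
  rw [hTe] at hw
  have hT0 : (0 : ℝ) ≤ T := by
    have : (0 : ℝ) ≤ ((dyNum T s.j : ℕ) : ℝ) / 2 ^ s.j := by positivity
    rwa [hTe] at this
  have hmono : reDigammaQuarter T ≤ reDigammaQuarter |t| :=
    reDigammaQuarter_mono (by rwa [abs_abs, abs_of_nonneg hT0])
  have hlev' : (s.K : ℝ) * wL + ((s.c2 : ℝ) + 1) + ((s.c3 : ℝ) + 1) ≤
      (s.K : ℝ) * (wLoZ s.p (dyNum T s.j) s.j s.M : ℝ) := by exact_mod_cast hlev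
  -- assemble
  have ew : weilTwoPrimeWeight t + s.phantom t =
      reDigammaQuarter |t| + (-(Real.sqrt 2 * Real.log 2) * Real.cos (|t| * Real.log 2) + harmSum s.K s.zs (|t| * Real.log 2)) +
        (-(2 * Real.log 3 / Real.sqrt 3) * Real.cos (|t| * Real.log 3) + harmSum s.K s.ys (|t| * Real.log 3)) := by
    unfold phantom sepPhantomZ weilTwoPrimeWeight
    rw [reDigammaQuarter_abs, cos_abs_mul, cos_abs_mul, harmSum_abs_mul, harmSum_abs_mul]
    ring
  rw [ew]
  have hdiv : (wL : ℝ) + ((s.c2 : ℝ) + 1) / s.K + ((s.c3 : ℝ) + 1) / s.K ≤ (wLoZ s.p (dyNum T s.j) s.j s.M : ℝ) := by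
    have := div_le_div_of_nonneg_right hlev' hKr.le
    rw [show ((s.K : ℝ) * wL + ((s.c2 : ℝ) + 1) + ((s.c3 : ℝ) + 1)) / s.K =
        (wL : ℝ) + ((s.c2 : ℝ) + 1) / s.K + ((s.c3 : ℝ) + 1) / s.K by field_simp,
      mul_div_assoc, ← mul_div_assoc, mul_div_cancel_left₀ _ hKr.ne'] at this
    exact this
  linarith

end SepLevelCP

/-! ## Instance: the level of the calibration certificate M80X (b = 4023/5000, T80 chain, minimal 4-ripple phantom) -/

/-- The level certificate of M80X: `K = 2^16`, phantom `P(t) = (23811 cos(3t log 2) − 11087 cos(4t log 2) + 45938 cos(2t log 3) −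
14183 cos(3t log 3))/2^16` (harmonics `j = 3, 4 ≥ 2·(4023/5000)/log 2` and `k = 2, 3 ≥ 2·(4023/5000)/log 3` are phantom-legal),
certified one-prime dips `m₂ = 51561/2^16 = 0.78676`, `m₃ = 51426/2^16 = 0.78470`. [folklore] -/
def sepLevelM80X : SepLevelCP :=
  ⟨65536, 64242, 83137, 51560, 51425, [0, 23811, -11087], [45938, -14183], 2 ^ 24, 14, 120, 5, 40000⟩

/-- The M80X level certificate passes at `wL' = 2116/1000`, `T = 80` (`2.116 + 0.78676 + 0.78470 = 3.68746 ≤ wLoZ(80) = 3.688873`). [folklore] -/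
theorem sepLevelM80X_check : sepLevelM80X.check (2116 / 1000) 80 = true := by
  decide +kernel

/-- **Tail level of M80X**: for `|t| ≥ 80`, `2.116 ≤ w₂₃(t) + P(t)`. [folklore] -/
theorem level_M80X {t : ℝ} (ht : (80 : ℝ) ≤ |t|) :
    ((2116 / 1000 : ℚ) : ℝ) ≤ weilTwoPrimeWeight t + sepLevelM80X.phantom t := by
  have h := SepLevelCP.level_of_check sepLevelM80X_check (t := t) (by exact_mod_cast ht)
  exact h

end Summit.RiemannHypothesis.RiemannHypothesis.Theorems.EvenWinsBeyondArch

end
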